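import Literature.IUT.HodgeArakelov.ThetaEvaluationSettingProofs2
import Literature.AnabelianGeometry.EtaleTheta.Discharge.Sec2Prop24CharacteristicY
import HarnessLib

/-!
# [IUTchII] Prop. 2.1: the anabelian input "reconstructed from `Π^tp_{X̲̲_v}`" supplied by [EtTh] Prop. 2.4

S. Mochizuki, *Inter-universal Teichmüller theory II*, kurims manuscript (Dec. 2020) §2, Prop. 2.1
pp. 64–65 (claim key `Mochizuki2012`, DISPUTED, D-0012); [EtTh] Prop. 2.4 (Publ. RIMS **45** (2009),
PDF p. 38) [cite: MochizukiEtTh2009, Prop 2.4 p.38]. Proof-only companion (abc-iut cell, D-0067 wave 4,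
seat abc-iut-w4-d034; cone of [IUTchIII] Cor. 3.12, DAG node **IUTchII:Prop2.1**; GAP-LEDGER row
G-w4d010-3); no definitions, no new named fact; the audited modules `ThetaEvaluationSetting*.lean`
(abc-iut-L6-t1, abc-iut-w4-d010) and `ThetaCoversTempered.lean` (abc-iut-L2-t2) are imported unchanged.
Nothing here takes a side on [IUTchIII] Cor. 3.12; typed ≠ proved.

THE GAP ROW. abc-iut-w4-d010's `TemperedCoverings.YL_eq_of_characteristic` (p411925) proves the
WELL-DEFINEDNESS clause of [IUTchII] Prop. 2.1 ("may be reconstructed … from `Π^tp_{X̲̲_v}`", p. 65) under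
two explicit hypotheses `hY`, `hYdd`: the reference subgroups `Π^tp_{Y̲_v} = Π^tp_{X̲̲_v} ∩ Π^tp_{Y_v}` and
`Π^tp_{Ÿ̲_v} = Π^tp_{X̲̲_v} ∩ Π^tp_{Ÿ_v}` of the `BadPlaceSetting` are characteristic in the topological group
`Π^tp_{X̲̲_v}` (`EtaleTheta.IsTopCharacteristic`). GAP-LEDGER G-w4d010-3 records that the printed input,
[EtTh] Prop. 2.4, IS pre-registered in L2's vocabulary (`ThetaCovers.TemperedCoverData.Prop24`) and that
"what is missing is the BRIDGE `TemperedCoverData.Prop24 → IsTopCharacteristic` of the two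
`BadPlaceSetting` reference subgroups". This file is that bridge, over IDENTIFICATION DATA ONLY (no new
`Prop` fact): an isomorphism of topological groups `eX : Π_v ≅ Π^tp_{X̲̲}` onto the member `Π^tp_{X̲̲}` of
L2's tempered tower under which the two reference subgroups of the `BadPlaceSetting` correspond to
`Π^tp_{X̲̲} ∩ Π^tp_Y`, `Π^tp_{X̲̲} ∩ Π^tp_Ÿ` — exactly the shape the pending MERGE `BadPlaceSetting`
TODO-merge:abc-iut-L2-t1/t2 will instantiate (with `eX` the identity).

* `BadPlaceSetting.isTopCharacteristic_refY_refYdd_of_prop24` — `T.Prop24` (clause (i)) ⟹ `hY ∧ hYdd`,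
  via abc-iut-w4-d034's `TemperedCoverData.isTopCharacteristic_PiYtp_subgroupOf_of_prop24` /
  `…_PiYddtp_…` (`Discharge/Sec2Prop24CharacteristicY.lean`: the `Ÿ`-clause is in the printed stabiliser
  list of Prop. 2.4; the `Y`-clause is GROUP THEORY — `Π^tp_X/Π^tp_Y ≅ ℤ` torsion-free and
  `[Π^tp_Y : Π^tp_Ÿ] = 2`) and transport of characteristic subgroups along `eX`.
* `BadPlaceSetting.isTopCharacteristic_refY_refYdd_of_prop24'` — the same with the identification given
  member-wise (`S.inclPlain x ∈ S.refY ↔ eX x ∈ Π^tp_Y`, …).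
* `TemperedCoverings.YL_eq_of_prop24` — composition with p411925: granted Prop. 2.4 and the
  identification, any two Prop. 2.1 outputs over the same `P` have the same top row.

[claim: Mochizuki2012, status: disputed] Deliberately NOT here: the construction of a `BadPlaceSetting`
from [EtTh]/[IUTchI] data (the merge itself; owners abc-iut-L6-t1 / abc-iut-L2-t2), the existence half of
[EtTh] Prop. 2.4 (the named fact `Prop24`, FACT-LIST), anything on Prop. 2.2.
-/

namespace Literature.IUT.HodgeArakelov

universe u

open Literature.AnabelianGeometry.EtaleTheta
open Literature.AnabelianGeometry.EtaleTheta.ThetaCovers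

variable (S : BadPlaceSetting.{u}) {l : ℕ} (T : TemperedCoverData.{u} l)

/-- **[IUTchII] Prop. 2.1 ⟸ [EtTh] Prop. 2.4 (the bridge of GAP-LEDGER G-w4d010-3).** Let the reference
group `Π_v = Π^tp_{X̲̲_v}` of a `BadPlaceSetting` be identified, by an isomorphism of topological groups
`eX`, with the member `Π^tp_{X̲̲}` of the tempered tower of a `TemperedCoverData`, in such a way that the
reference subgroups `Π^tp_{Y̲_v} = Π_v ∩ Π^tp_{Y_v}` and `Π^tp_{Ÿ̲_v} = Π_v ∩ Π^tp_{Ÿ_v}` correspond to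
`Π^tp_{X̲̲} ∩ Π^tp_Y` and `Π^tp_{X̲̲} ∩ Π^tp_Ÿ`. Then [EtTh] Prop. 2.4 ("any isomorphism … induces
isomorphisms … between the respective `Π^tp`'s of `X̲̲, X̲, X, C̲̲, C̲, C, Ÿ`", clause (i) of the named fact
`Prop24`, taken as a hypothesis) implies that both reference subgroups are CHARACTERISTIC in the
topological group `Π_v` — the hypotheses `hY`, `hYdd` of `TemperedCoverings.YL_eq_of_characteristic`.
[claim: Mochizuki2012, status: disputed] -/
theorem BadPlaceSetting.isTopCharacteristic_refY_refYdd_of_prop24 (hP : T.Prop24)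
    (eX : S.PiX ≃ₜ* ↥(T.tp T.PiXuu))
    (hY : S.refY.comap S.inclPlain =
      (T.PiYtp.subgroupOf (T.tp T.PiXuu)).comap eX.toMulEquiv.toMonoidHom)
    (hYdd : S.refYdd.comap S.inclPlain =
      (T.PiYddtp.subgroupOf (T.tp T.PiXuu)).comap eX.toMulEquiv.toMonoidHom) :
    IsTopCharacteristic S.PiX (S.refY.comap S.inclPlain) ∧
      IsTopCharacteristic S.PiX (S.refYdd.comap S.inclPlain) := by
  refine ⟨?_, ?_⟩
  · rw [hY]
    exact (T.isTopCharacteristic_PiYtp_subgroupOf_of_prop24 hP).comap_continuousMulEquiv S.PiX eX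
  · rw [hYdd]
    exact (T.isTopCharacteristic_PiYddtp_subgroupOf_of_prop24 hP).comap_continuousMulEquiv S.PiX eX

/-- The same bridge with the identification of the reference subgroups given MEMBER-WISE:
`S.inclPlain x ∈ Π^tp_{Y_v} ↔ eX x ∈ Π^tp_Y` and `S.inclPlain x ∈ Π^tp_{Ÿ_v} ↔ eX x ∈ Π^tp_Ÿ` for all
`x ∈ Π_v`. [claim: Mochizuki2012, status: disputed] -/
theorem BadPlaceSetting.isTopCharacteristic_refY_refYdd_of_prop24' (hP : T.Prop24)
    (eX : S.PiX ≃ₜ* ↥(T.tp T.PiXuu))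
    (hY : ∀ x : S.PiX, S.inclPlain x ∈ S.refY ↔ ((eX x : ↥(T.tp T.PiXuu)) : T.Gtp) ∈ T.PiYtp)
    (hYdd : ∀ x : S.PiX, S.inclPlain x ∈ S.refYdd ↔ ((eX x : ↥(T.tp T.PiXuu)) : T.Gtp) ∈ T.PiYddtp) :
    IsTopCharacteristic S.PiX (S.refY.comap S.inclPlain) ∧
      IsTopCharacteristic S.PiX (S.refYdd.comap S.inclPlain) := by
  refine S.isTopCharacteristic_refY_refYdd_of_prop24 T hP eX ?_ ?_
  · ext x
    rw [Subgroup.mem_comap, Subgroup.mem_comap, Subgroup.mem_subgroupOf]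
    exact hY x
  · ext x
    rw [Subgroup.mem_comap, Subgroup.mem_comap, Subgroup.mem_subgroupOf]
    exact hYdd x

variable {S} in
/-- **[IUTchII] Prop. 2.1, well-definedness granted [EtTh] Prop. 2.4** (composition with abc-iut-w4-d010's
`TemperedCoverings.YL_eq_of_characteristic`, p411925): under the identification of `Π_v` with `Π^tp_{X̲̲}`
as above and Prop. 2.4 (clause (i) of `Prop24`), any two Prop. 2.1 outputs over the same topological group
`P` have the same top row `Π^tp_{Ÿ̲_v} ⊆ Π^tp_{Y̲_v} ⊆ P` ("may be reconstructed … from `Π^tp_{X̲̲_v}`",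
kurims p. 65). [claim: Mochizuki2012, status: disputed] -/
theorem TemperedCoverings.YL_eq_of_prop24 {P : TopGroup.{u}} (hP : T.Prop24)
    (eX : S.PiX ≃ₜ* ↥(T.tp T.PiXuu))
    (hY : S.refY.comap S.inclPlain =
      (T.PiYtp.subgroupOf (T.tp T.PiXuu)).comap eX.toMulEquiv.toMonoidHom)
    (hYdd : S.refYdd.comap S.inclPlain =
      (T.PiYddtp.subgroupOf (T.tp T.PiXuu)).comap eX.toMulEquiv.toMonoidHom)
    (T₁ T₂ : TemperedCoverings S P) : T₁.YL = T₂.YL ∧ T₁.YddL = T₂.YddL :=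
  have h := S.isTopCharacteristic_refY_refYdd_of_prop24 T hP eX hY hYdd
  TemperedCoverings.YL_eq_of_characteristic h.1 h.2 T₁ T₂

end Literature.IUT.HodgeArakelov
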